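import Summits.BirchSwinnertonDyer.BirchSwinnertonDyer.Theorems.PrintX10bBeyondCarrierUpperLinkHalvesOfLevel
import Summits.BirchSwinnertonDyer.BirchSwinnertonDyer.Theorems.PrintX10bBeyondCarrierOfUpperLinkV5
import Summits.BirchSwinnertonDyer.BirchSwinnertonDyer.Theorems.PrintX9MuInequalityCoherentPairOfPrintCG
import Summits.BirchSwinnertonDyer.BirchSwinnertonDyer.Theorems.PrintX9MuPartOfPrintKSClosed
import Summits.BirchSwinnertonDyer.BirchSwinnertonDyer.Theorems.PrintX10bTwoSidedLinkAnyClassNumberX10bPinnedByName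
import Literature.NumberTheory.EllipticCurves.AnticyclotomicTowerSharpProofs
import HarnessLib

/-!
# Crux `BeyondCarrierDepthX10b` (stmt-BirchSwinnertonDyer-23055, PrintX10b aside r301), line «twins» — CENSUS OF RECORD after
# the finding «hC-IDLE» and the CG-FRAME discharge: the crux BY NAME from TWELVE cite-only print facts, nothing else

HONEST FRAMING (cell `run/shared/lean/pub/bsd-print-x9/`, seat bsd-line-x10b-p1-w8 g9, «GO w8» bsd-line-x10b-p1 LEAD g10 01:37:40Z;
registered line «twins», skeleton v8 `Cruxes/BeyondCarrierDepthX10b/Lines/twins.lean` sha d9aa95dab226; D-0154 row 10): THEOREMS ONLY,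
conditional glue `--supports 23055`; nothing booked, nothing closed. «beyond-print theorem»: NO. BSD is not proved by any of this; no
summit statement is proved by this seat.

WHY. The census of record p681886 (`beyondCarrierDepthX10b_of_printLeaves`, LEAD g10) reads the crux BY NAME from FOURTEEN cite-only
print facts. Two of them leave the list:
* `hC` (Carayol 1986: level of the newform = conductor, the `IsNewformOf` level fact over every level `N`) is IDLE — its one
  use (`CompositeTransferX10b.composite_of_printFacts_of_pinnedTransfer`, `hC N Dt.isNewformOf : N = N_E`) learns the level of a
  parametrisation datum that the caller (`hN : W.conductorNorm ℤ = N`) and the crux (`Dt : ModularParametrizationData W (W.conductorNorm ℤ)`)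
  already pin; re-threaded hC-free in p686788 (`…OfPrintFactsPinnedLevel.lean`) and `…UpperLinkHalvesOfLevel.lean`;
* `hCG : Greenberg1999.imKummer_eq_strictCondition_goodOrdinary_numberField` (Greenberg LNM 1716 Prop. 2.4) is DISCHARGED on the
  rows-9/10 frames: the CG-FRAME chain ((A) p684158 · (B) p682916 · (C1)/(C2) p683516/p685581 · (C-core) p684390 · (C-frame) p683394 ·
  (C-asm-transport) p683836 · (D) p683506 · conj-place p684731 · (E) F1–F5 · (KS-asm) p685979 `kummerStrictOnFrames_holds`) makes the
  μ-letter the route-free theorem `HeegnerMuPartOfPrintKSClosed.muPartStabilizedCoherentPair_of_thm161_thm411` (p686226) of the two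
  leaves F-161 (Howard Thm. 1.6.1) and F-411 (CGLS Thm. 4.1.1, Kolyvagin-system typing).
So: **crux 23055 BY NAME ⟸ 12 cite-only PRINT facts** — ZERO research statements, ZERO classical stubs, no Carayol, no Greenberg 2.4.

WHAT.
* `beyondCarrierDepthX10b_of_muPartStabilizedCoherentPair_of_elevenFacts (h46 hNV hCGLS hTw h57 h59gp h422 h513 h331 hChaL hKo) (hμ)` —
  p631498's BY-NAME composition minus `hC`.
* `beyondCarrierDepthX10b_of_thirteenPrintLeaves_of_level (… h161 h411 hCG)` — p681886's census minus `hC` (μ := `…_of_leaves`).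
* **`beyondCarrierDepthX10b_of_twelvePrintLeaves (h46 hNV hCGLS h57 h59gp h422 h513 h331 hChaL hKo h161 h411) : BeyondCarrierDepthX10b`**
  — THE CENSUS OF RECORD: eleven-fact composition ∘ `anticyclotomicTowerSharp` ∘ `muPartStabilizedCoherentPair_of_thm161_thm411`.
* `beyondCarrierDepthX10b_of_twelveNamedLeaves` — the same with the inline transfer `h59gp` supplied BY NAME from the Literature fact
  `YanZhu2026.thm59_localised_pinned_anyClassNumber` (lit g25 p610320, REF-111 PASS) via `PinnedByName.pinnedTransfer_of_thm59`
  (x10b-p3): twelve leaves, every one a NAMED Literature `Prop`.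
References: as in p681886 / p631498; [Carayol1986] and [Greenberg1999] Prop. 2.4 are the two leaves that left.
-/

-- the REGISTERED stub namespace `Summit.BirchSwinnertonDyer.BirchSwinnertonDyer.Cruxes.…` repeats the summit name
set_option linter.dupNamespace false
set_option autoImplicit false

noncomputable section

open scoped Classical Pointwise

open WeierstrassCurve NumberField IsDedekindDomain Field Literature.NumberTheory.EllipticCurves
  Literature.NumberTheory.EllipticCurves.ModularForms Literature.NumberTheory.EllipticCurves.Rank1Residual
  Literature.NumberTheory.EllipticCurves.Castella2018 Literature.NumberTheory.EllipticCurves.YanZhu2026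
  Literature.NumberTheory.EllipticCurves.CastellaGrossiLeeSkinner2022
  Literature.NumberTheory.EllipticCurves.JetchevSkinnerWan2017
open Summit.BirchSwinnertonDyer.Rank1Residual
open Summit.BirchSwinnertonDyer.BirchSwinnertonDyer.Cruxes.BeyondCarrierDepthX10b.UpperHalf
  (upperLinkX10b_coprimeClassNumber_of_pinnedPrintFacts_of_level)
open Summit.BirchSwinnertonDyer.BirchSwinnertonDyer.Cruxes.TwoSidedLinkAnyClassNumberX10b.PinnedByName (pinnedTransfer_of_thm59)
open Summit.BirchSwinnertonDyer.BirchSwinnertonDyer.Theorems.HeegnerMuPartStabilized (MuPartStabilizedCoherentPair)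
open Summit.BirchSwinnertonDyer.BirchSwinnertonDyer.Theses.PrintX10b (BeyondCarrierDepthX10b)

namespace Summit.BirchSwinnertonDyer.BirchSwinnertonDyer.Cruxes.BeyondCarrierDepthX10b.HowardFrames

/-- **Crux 23055 `BeyondCarrierDepthX10b` BY NAME from the coherent-pair μ-letter L∃, modulo ELEVEN cite-only facts (the
Carayol leaf struck)** — verbatim `beyondCarrierDepthX10b_of_muPartStabilizedCoherentPair_of_namedFacts` (p631498) with the binder
`hC` DELETED: `h46` MZ26 Cor. 4.6 (the `3 ∤ h_K` frames); `hNV hCGLS hTw` (the `3 ∣ h_K` frames); `h57 h59gp h422 h513` the pinned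
transfer; `h331` JSW control; `hChaL hKo` the glue U₃ → body; `hμ` the letter. Coprime half:
`upperLinkX10b_coprimeClassNumber_of_pinnedPrintFacts_of_level`; divisible half:
`upperLinkX10b_divisibleClassNumber_of_muPartStabilizedCoherentPair_of_printFacts_of_level`; glue:
`stub_beyondCarrier_of_upperLink_of_namedFacts` (p609388). CONDITIONAL; credits nothing.
[cite: MastellaZerman2026, Cor. 4.6] [cite: CastellaGrossiLeeSkinner2022, Thm. 4.1.1, Thm. 4.1.3 and Thm. 5.1.3]
[cite: Howard2004HeegnerKolyvagin, Thm. 2.2.10 (proof)] [cite: YanZhu2024MainConjNonCM, Thm. 5.7 (1), 5.9]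
[cite: BurungaleCastellaSkinner2025, Prop. 4.2.2] [cite: JetchevSkinnerWan2017, Thm. 3.3.1] [cite: Cha2005, Rmk. 25]
[cite: Kolyvagin1990, Thm. A] -/
theorem beyondCarrierDepthX10b_of_muPartStabilizedCoherentPair_of_elevenFacts
    (h46 : MastellaZerman2026.cor46_howardDivisibility_of_scalarImage.{0})
    (hNV : thm411_torsionFree_heegnerClass_ne_bot_quotient_isTorsion.{0})
    (hCGLS : thm413_rankOne_charIdeal_torsion_dvd_localized.{0})
    (hTw : ∀ (K : Type) [Field K] [NumberField K] (p : ℕ) [Fact p.Prime], Odd p →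
      Literature.NumberTheory.EllipticCurves.IsImaginaryQuadratic K →
      ∀ (κ : Literature.NumberTheory.EllipticCurves.ZpExtension K p), κ.IsAnticyclotomic →
      ∀ (jbar : AlgebraicClosure K →+* ℂ) (k : ℕ),
      Literature.NumberTheory.EllipticCurves.ringClassSubgroup K (p ^ (k + 1)) jbar ≤ κ.layerSubgroup k)
    (h57 : thm57_isTorsion_charIdealXGr_eq_bdpLFunction)
    (h59gp : ∀ {p : ℕ} [Fact p.Prime] (ι' : PadicAlgCl p ≃+* ℂ) (W : WeierstrassCurve ℚ) [W.IsElliptic]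
      [W.IsGloballyMinimal] (K : Type) [Field K] [NumberField K] (v vbar : HeightOneSpectrum (𝓞 K))
      (κ : ZpExtension K p) (γ : absoluteGaloisGroup K) [Fact (κ.IsTopGenerator γ)] {N : ℕ} [NeZero N]
      {f : CuspForm (CongruenceSubgroup.Gamma0 N) 2} (jbar : AlgebraicClosure K →+* ℂ)
      (_ : IsNewformOf W f),
      N = W.conductorNorm ℤ → 3 ≤ p → GoodOrd W p → (W.baseChange K).HasIrreducibleModPGaloisRep p →
      IsImaginaryQuadratic K → SatisfiesHeegnerHypothesis N K →
        ((Ideal.span {(p : ℤ)}).primesOver (𝓞 K)).ncard = 2 →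
        Odd (NumberField.discr K) → NumberField.discr K ≠ -3 → κ.IsAnticyclotomic →
      (∀ (w : InfinitePlace K) (k : 𝓞 K), k ∈ v.asIdeal ↔ ‖ι'.symm (w.embedding (k : K))‖ < 1) →
        ((p : ℕ) : 𝓞 K) ∈ vbar.asIdeal → vbar ≠ v →
      ∃ (ΩK : ℂ) (Ωp : (unrIntegers p)ˣ) (L : UnrSeries p),
        ΩK ≠ 0 ∧ IsBDPLFunction ι' v κ γ f ΩK ((Ωp : unrIntegers p) : ℂ_[p]) L ∧
        ∀ (D : (W.baseChange K).LambdaAdicSelmerData κ γ) (F : HeegnerFamily N W K κ jbar)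
          (X : (W.baseChange K).SelmerDualData κ γ) (j : ℤ_[p] →+* unrIntegers p),
          ¬ (p : ℤ) ∣ F.Dt.c →
          (∀ x : ℤ_[p], ((j x : unrIntegers p) : ℂ_[p]) = algebraMap ℚ_[p] ℂ_[p] (x : ℚ_[p])) →
          heegnerCharIdeal D F ^ 2 ≤
              Module.charIdeal (IwasawaAlgebra p) (Submodule.torsion (IwasawaAlgebra p) X.X) →
            L ∈ (AcSelmer.XAc.charIdeal (W.baseChange K) p κ vbar ∅ γ).map (PowerSeries.map j))
    (h422 : BurungaleCastellaSkinner2025.prop422_exists_isBDPLFunction_mu_eq_zero)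
    (h513 : thm513_exists_isBDPLFunction_valueAtOne_disc)
    (h331 : thm331_anticyclotomicControl)
    (hChaL : Cha2005.rmk25_pow_dvd_card_sha_primary_of_certificate)
    (hKo : ∀ (N : ℕ) [NeZero N] (W : WeierstrassCurve ℚ) (K : Type) [Field K] [NumberField K],
      kolyvagin N W K)
    (hμ : MuPartStabilizedCoherentPair) :
    BeyondCarrierDepthX10b := by
  refine stub_beyondCarrier_of_upperLink_of_namedFacts h331 hChaL hKo ?_
  intro W _ _ p _ _ K _ _ hX hns hcm hK hodd h3 hHN hHp hirr ι κ hκ γ _ Dt hc H ιC P hP hrk hfin hPinf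
  by_cases hh : p ∣ NumberField.classNumber K
  · exact upperLinkX10b_divisibleClassNumber_of_muPartStabilizedCoherentPair_of_printFacts_of_level hNV hCGLS hTw
      h57 h59gp h422 h513 h331 hμ W p K hX hns hcm hK hodd h3 hHN hHp hh hirr ι κ hκ γ Dt hc H ιC P hP hrk hfin hPinf
  · exact upperLinkX10b_coprimeClassNumber_of_pinnedPrintFacts_of_level h46 h57 h59gp h422 h513 h331 W p K hX
      hns hcm hK hodd h3 hHN hHp hirr hh ι κ hκ γ Dt hc H ιC P hP hrk hfin hPinf

/-- **Crux `BeyondCarrierDepthX10b` BY NAME from THIRTEEN cite-only print facts (the census p681886 with the Carayol leaf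
struck)**: `h46` · `hNV`/`h411` (CGLS Thm. 4.1.1, two typings) · `hCGLS` · `h57 h59gp h422 h513 h331` · `hChaL` · `hKo` · `h161`
(Howard Thm. 1.6.1) · `hCG` (Greenberg Prop. 2.4); the μ-part is the kernel theorem `muPartStabilizedCoherentPair_of_leaves` (p680258),
the tower clause the kernel theorem `anticyclotomicTowerSharp` (p681041). What is NOT proved: any of the thirteen leaves; the crux
unconditionally; BSD. CONDITIONAL; credits nothing. [cite: MastellaZerman2026, Cor. 4.6]
[cite: CastellaGrossiLeeSkinner2022, Thm. 4.1.1, Thm. 4.1.3 and Thm. 5.1.3] [cite: Howard2004HeegnerKolyvagin, Thm. 1.6.1 and Thm. 2.2.10 (proof)]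
[cite: Greenberg1999, Prop. 2.4] [cite: YanZhu2024MainConjNonCM, Thm. 5.7 (1), 5.9] [cite: BurungaleCastellaSkinner2025, Prop. 4.2.2]
[cite: JetchevSkinnerWan2017, Thm. 3.3.1] [cite: Cha2005, Rmk. 25] [cite: Kolyvagin1990, Thm. A] [cite: Cox2013, §7.D Thm. 7.24 and §11.A Thm. 11.1] -/
theorem beyondCarrierDepthX10b_of_thirteenPrintLeaves_of_level
    (h46 : MastellaZerman2026.cor46_howardDivisibility_of_scalarImage.{0})
    (hNV : thm411_torsionFree_heegnerClass_ne_bot_quotient_isTorsion.{0})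
    (hCGLS : thm413_rankOne_charIdeal_torsion_dvd_localized.{0})
    (h57 : thm57_isTorsion_charIdealXGr_eq_bdpLFunction)
    (h59gp : ∀ {p : ℕ} [Fact p.Prime] (ι' : PadicAlgCl p ≃+* ℂ) (W : WeierstrassCurve ℚ) [W.IsElliptic]
      [W.IsGloballyMinimal] (K : Type) [Field K] [NumberField K] (v vbar : HeightOneSpectrum (𝓞 K))
      (κ : ZpExtension K p) (γ : absoluteGaloisGroup K) [Fact (κ.IsTopGenerator γ)] {N : ℕ} [NeZero N]
      {f : CuspForm (CongruenceSubgroup.Gamma0 N) 2} (jbar : AlgebraicClosure K →+* ℂ)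
      (_ : IsNewformOf W f),
      N = W.conductorNorm ℤ → 3 ≤ p → GoodOrd W p → (W.baseChange K).HasIrreducibleModPGaloisRep p →
      IsImaginaryQuadratic K → SatisfiesHeegnerHypothesis N K →
        ((Ideal.span {(p : ℤ)}).primesOver (𝓞 K)).ncard = 2 →
        Odd (NumberField.discr K) → NumberField.discr K ≠ -3 → κ.IsAnticyclotomic →
      (∀ (w : InfinitePlace K) (k : 𝓞 K), k ∈ v.asIdeal ↔ ‖ι'.symm (w.embedding (k : K))‖ < 1) →
        ((p : ℕ) : 𝓞 K) ∈ vbar.asIdeal → vbar ≠ v →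
      ∃ (ΩK : ℂ) (Ωp : (unrIntegers p)ˣ) (L : UnrSeries p),
        ΩK ≠ 0 ∧ IsBDPLFunction ι' v κ γ f ΩK ((Ωp : unrIntegers p) : ℂ_[p]) L ∧
        ∀ (D : (W.baseChange K).LambdaAdicSelmerData κ γ) (F : HeegnerFamily N W K κ jbar)
          (X : (W.baseChange K).SelmerDualData κ γ) (j : ℤ_[p] →+* unrIntegers p),
          ¬ (p : ℤ) ∣ F.Dt.c →
          (∀ x : ℤ_[p], ((j x : unrIntegers p) : ℂ_[p]) = algebraMap ℚ_[p] ℂ_[p] (x : ℚ_[p])) →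
          heegnerCharIdeal D F ^ 2 ≤
              Module.charIdeal (IwasawaAlgebra p) (Submodule.torsion (IwasawaAlgebra p) X.X) →
            L ∈ (AcSelmer.XAc.charIdeal (W.baseChange K) p κ vbar ∅ γ).map (PowerSeries.map j))
    (h422 : BurungaleCastellaSkinner2025.prop422_exists_isBDPLFunction_mu_eq_zero)
    (h513 : thm513_exists_isBDPLFunction_valueAtOne_disc)
    (h331 : thm331_anticyclotomicControl)
    (hChaL : Cha2005.rmk25_pow_dvd_card_sha_primary_of_certificate)
    (hKo : ∀ (N : ℕ) [NeZero N] (W : WeierstrassCurve ℚ) (K : Type) [Field K] [NumberField K],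
      kolyvagin N W K)
    (h161 : Literature.NumberTheory.GaloisCohomology.Howard2004.thm161_dvrKolyvaginBound)
    (h411 : CastellaGrossiLeeSkinner2022.thm411_exists_kolyvaginSystem_one_ne_zero)
    (hCG : Greenberg1999.imKummer_eq_strictCondition_goodOrdinary_numberField) :
    BeyondCarrierDepthX10b :=
  beyondCarrierDepthX10b_of_muPartStabilizedCoherentPair_of_elevenFacts h46 hNV hCGLS
    anticyclotomicTowerSharp h57 h59gp h422 h513 h331 hChaL hKo
    (Theorems.HeegnerMuPartOfPrintCGClosed.muPartStabilizedCoherentPair_of_leaves h161 h411 hCG)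

/-- **CENSUS OF RECORD (2026-08-29) — crux `BeyondCarrierDepthX10b` BY NAME from TWELVE cite-only print facts, nothing else**:
`h46` MZ26 Cor. 4.6 · `hNV`/`h411` CGLS Thm. 4.1.1 (torsion typing / Kolyvagin-system typing) · `hCGLS` CGLS Thm. 4.1.3 · `h57` (Castella
BDP / Yan–Zhu Thm. 5.7 (1)) · `h59gp` (the pinned transfer, inline) · `h422` BCS Prop. 4.2.2 · `h513` CGLS Thm. 5.1.3 · `h331` JSW
Thm. 3.3.1 · `hChaL` Cha Rmk. 25 · `hKo` Kolyvagin Thm. A · `h161` Howard Thm. 1.6.1. Struck from p681886's fourteen: the Carayol leaf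
`hC` (idle — the crux pins the level of `Dt` to `N_E`; p686788 and the companion `…UpperLinkHalvesOfLevel.lean`) and Greenberg
Prop. 2.4 `hCG` (DISCHARGED on the rows-9/10 frames in the kernel: the μ-part is the route-free KS letter
`HeegnerMuPartOfPrintKSClosed.muPartStabilizedCoherentPair_of_thm161_thm411` (x9-p1 LEAD g6, p686226) over the CG-FRAME chain
`kummerStrictOnFrames_holds` (p685979) and the closed stubs of the shared μ-crux 23428). The tower clause is the kernel theorem
`anticyclotomicTowerSharp` (p681041). What is NOT proved: any of the twelve leaves; the crux unconditionally; BSD. CONDITIONAL;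
credits nothing. [cite: MastellaZerman2026, Cor. 4.6] [cite: CastellaGrossiLeeSkinner2022, Thm. 4.1.1, Thm. 4.1.3 and Thm. 5.1.3]
[cite: Howard2004HeegnerKolyvagin, Thm. 1.6.1 and Thm. 2.2.10 (proof)] [cite: YanZhu2024MainConjNonCM, Thm. 5.7 (1), 5.9]
[cite: BurungaleCastellaSkinner2025, Prop. 4.2.2] [cite: JetchevSkinnerWan2017, Thm. 3.3.1] [cite: Cha2005, Rmk. 25]
[cite: Kolyvagin1990, Thm. A] [cite: Greenberg1999, Prop. 2.4 (discharged on the frames)] [cite: Cox2013, §7.D Thm. 7.24 and §11.A Thm. 11.1] -/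
theorem beyondCarrierDepthX10b_of_twelvePrintLeaves
    (h46 : MastellaZerman2026.cor46_howardDivisibility_of_scalarImage.{0})
    (hNV : thm411_torsionFree_heegnerClass_ne_bot_quotient_isTorsion.{0})
    (hCGLS : thm413_rankOne_charIdeal_torsion_dvd_localized.{0})
    (h57 : thm57_isTorsion_charIdealXGr_eq_bdpLFunction)
    (h59gp : ∀ {p : ℕ} [Fact p.Prime] (ι' : PadicAlgCl p ≃+* ℂ) (W : WeierstrassCurve ℚ) [W.IsElliptic]
      [W.IsGloballyMinimal] (K : Type) [Field K] [NumberField K] (v vbar : HeightOneSpectrum (𝓞 K))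
      (κ : ZpExtension K p) (γ : absoluteGaloisGroup K) [Fact (κ.IsTopGenerator γ)] {N : ℕ} [NeZero N]
      {f : CuspForm (CongruenceSubgroup.Gamma0 N) 2} (jbar : AlgebraicClosure K →+* ℂ)
      (_ : IsNewformOf W f),
      N = W.conductorNorm ℤ → 3 ≤ p → GoodOrd W p → (W.baseChange K).HasIrreducibleModPGaloisRep p →
      IsImaginaryQuadratic K → SatisfiesHeegnerHypothesis N K →
        ((Ideal.span {(p : ℤ)}).primesOver (𝓞 K)).ncard = 2 →
        Odd (NumberField.discr K) → NumberField.discr K ≠ -3 → κ.IsAnticyclotomic →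
      (∀ (w : InfinitePlace K) (k : 𝓞 K), k ∈ v.asIdeal ↔ ‖ι'.symm (w.embedding (k : K))‖ < 1) →
        ((p : ℕ) : 𝓞 K) ∈ vbar.asIdeal → vbar ≠ v →
      ∃ (ΩK : ℂ) (Ωp : (unrIntegers p)ˣ) (L : UnrSeries p),
        ΩK ≠ 0 ∧ IsBDPLFunction ι' v κ γ f ΩK ((Ωp : unrIntegers p) : ℂ_[p]) L ∧
        ∀ (D : (W.baseChange K).LambdaAdicSelmerData κ γ) (F : HeegnerFamily N W K κ jbar)
          (X : (W.baseChange K).SelmerDualData κ γ) (j : ℤ_[p] →+* unrIntegers p),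
          ¬ (p : ℤ) ∣ F.Dt.c →
          (∀ x : ℤ_[p], ((j x : unrIntegers p) : ℂ_[p]) = algebraMap ℚ_[p] ℂ_[p] (x : ℚ_[p])) →
          heegnerCharIdeal D F ^ 2 ≤
              Module.charIdeal (IwasawaAlgebra p) (Submodule.torsion (IwasawaAlgebra p) X.X) →
            L ∈ (AcSelmer.XAc.charIdeal (W.baseChange K) p κ vbar ∅ γ).map (PowerSeries.map j))
    (h422 : BurungaleCastellaSkinner2025.prop422_exists_isBDPLFunction_mu_eq_zero)
    (h513 : thm513_exists_isBDPLFunction_valueAtOne_disc)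
    (h331 : thm331_anticyclotomicControl)
    (hChaL : Cha2005.rmk25_pow_dvd_card_sha_primary_of_certificate)
    (hKo : ∀ (N : ℕ) [NeZero N] (W : WeierstrassCurve ℚ) (K : Type) [Field K] [NumberField K],
      kolyvagin N W K)
    (h161 : Literature.NumberTheory.GaloisCohomology.Howard2004.thm161_dvrKolyvaginBound)
    (h411 : CastellaGrossiLeeSkinner2022.thm411_exists_kolyvaginSystem_one_ne_zero) :
    BeyondCarrierDepthX10b :=
  beyondCarrierDepthX10b_of_muPartStabilizedCoherentPair_of_elevenFacts h46 hNV hCGLS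
    anticyclotomicTowerSharp h57 h59gp h422 h513 h331 hChaL hKo
    (Theorems.HeegnerMuPartOfPrintKSClosed.muPartStabilizedCoherentPair_of_thm161_thm411 h161 h411)

/-- **The census with EVERY leaf a NAMED Literature `Prop`** — `beyondCarrierDepthX10b_of_twelvePrintLeaves` with the inline pinned
transfer `h59gp` supplied BY NAME: `h59 : YanZhu2026.thm59_localised_pinned_anyClassNumber` (Yan–Zhu 2026 Thm. 5.9 = CGLS 2022
Prop. 4.2.1, (2) ⟹ (1), pinned, every class number; typed lit g25 p610320, REF-111 PASS), unfolded at `S = {1}` by x10b-p3's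
`PinnedByName.pinnedTransfer_of_thm59`. The twelve: `h46` MZ26 Cor. 4.6 · `hNV`/`h411` CGLS Thm. 4.1.1 · `hCGLS` CGLS Thm. 4.1.3 ·
`h57` Yan–Zhu Thm. 5.7 (1) · `h59` Yan–Zhu Thm. 5.9 · `h422` BCS Prop. 4.2.2 · `h513` CGLS Thm. 5.1.3 · `h331` JSW Thm. 3.3.1 · `hChaL`
Cha Rmk. 25 · `hKo` Kolyvagin Thm. A · `h161` Howard Thm. 1.6.1. CONDITIONAL; credits nothing.
[cite: MastellaZerman2026, Cor. 4.6] [cite: CastellaGrossiLeeSkinner2022, Thm. 4.1.1, Thm. 4.1.3, Prop. 4.2.1 and Thm. 5.1.3]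
[cite: Howard2004HeegnerKolyvagin, Thm. 1.6.1 and Thm. 2.2.10 (proof)] [cite: YanZhu2024MainConjNonCM, Thm. 5.7 (1), 5.9]
[cite: BurungaleCastellaSkinner2025, Prop. 4.2.2] [cite: JetchevSkinnerWan2017, Thm. 3.3.1] [cite: Cha2005, Rmk. 25]
[cite: Kolyvagin1990, Thm. A] -/
theorem beyondCarrierDepthX10b_of_twelveNamedLeaves
    (h46 : MastellaZerman2026.cor46_howardDivisibility_of_scalarImage.{0})
    (hNV : thm411_torsionFree_heegnerClass_ne_bot_quotient_isTorsion.{0})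
    (hCGLS : thm413_rankOne_charIdeal_torsion_dvd_localized.{0})
    (h57 : thm57_isTorsion_charIdealXGr_eq_bdpLFunction)
    (h59 : thm59_localised_pinned_anyClassNumber)
    (h422 : BurungaleCastellaSkinner2025.prop422_exists_isBDPLFunction_mu_eq_zero)
    (h513 : thm513_exists_isBDPLFunction_valueAtOne_disc)
    (h331 : thm331_anticyclotomicControl)
    (hChaL : Cha2005.rmk25_pow_dvd_card_sha_primary_of_certificate)
    (hKo : ∀ (N : ℕ) [NeZero N] (W : WeierstrassCurve ℚ) (K : Type) [Field K] [NumberField K],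
      kolyvagin N W K)
    (h161 : Literature.NumberTheory.GaloisCohomology.Howard2004.thm161_dvrKolyvaginBound)
    (h411 : CastellaGrossiLeeSkinner2022.thm411_exists_kolyvaginSystem_one_ne_zero) :
    BeyondCarrierDepthX10b :=
  beyondCarrierDepthX10b_of_twelvePrintLeaves h46 hNV hCGLS h57 (pinnedTransfer_of_thm59 h59) h422 h513 h331
    hChaL hKo h161 h411

end Summit.BirchSwinnertonDyer.BirchSwinnertonDyer.Cruxes.BeyondCarrierDepthX10b.HowardFrames

end
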